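import HarnessLib
import Literature.NumberTheory.LFunctions.WeilPositivityCertificate
import Summits.RiemannHypothesis.RiemannHypothesis.Theorems.SignConePointwiseChecker
import Summits.RiemannHypothesis.RiemannHypothesis.Theorems.SignConePointwiseLipschitz

/-!
# Route SignCone: the pointwise-certificate checker (data format and computable checks)

Support for the unconditional rungs of `SignConeOscillatory` / `SignConeInequality`
(items stmt-RiemannHypothesis-16302 / 16301). A pointwise certificate is rational data
`D : PWData` — a kernel `E_χ` (`PWKernel`), a slack `s`, fake weights `a n ≥ 0` on a list of nodes
and a slope constant — plus grids `0 = y_0 ≤ y_1 ≤ … ≤ y_N = Y₀`, and the claim is that the density of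
`SignConePointwiseIdentity.lean`,

  `F_D(y) = Re ψ(1/4 + iy/2) − log π + s + Ê_χ(y) − Σ_n a_n cos(y log n)`,

is non-negative for every real `y`. The checks verify this with the interval engine: on each
cell `[u, v]` it bounds `F_D` below by its value at `u` (certified lower bound of `Re ψ` at `u`,
monotone in `|y|`; `Ê_χ(u)` and the comb by the enclosures of `SignConePointwiseChecker.lean`) minus
`(v − u)·slope`, `slope ≥ ‖x E_χ‖₁ + Σ a_n log n` (the Lipschitz constants of `Ê_χ` and of the comb,
`SignConePointwiseLipschitz.lean`, `SignConePointwiseBounds.lean`); beyond `Y₀` it uses the decay `|Ê_χ(y)| ≤ decayConst/(¼ + y²)`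
and `cos ≤ 1`; negative `y` by evenness.

This file: `PWData`, `PWData.F`, and the computable checks `PWData.cellLo`, `cellOK`, `checkGrid`,
`chainOK`, `checkScalars` (the grid is split into several lists so that each kernel evaluation stays
small). Soundness (`PWData.F_nonneg_of_checks`) is in `SignConePointwiseCheckerSound.lean`.
-/

noncomputable section

-- `Summit.RiemannHypothesis.RiemannHypothesis.…` repeats a namespace component by design (D-0017 layout).
set_option linter.dupNamespace false

open Real

namespace Summit.RiemannHypothesis.RiemannHypothesis.Theorems.SignCone

open Literature.Analysis.ValidatedNumerics.Numerics Literature.NumberTheory.LFunctions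
open Literature.Analysis.SpecialFunctions (reDigammaQuarter reDigammaQuarter_mono reDigammaQuarter_even)

/-- **The data of a pointwise certificate.** [folklore] -/
structure PWData where
  /-- the kernel `E_χ` (plateau `L = 2b`, knot spacing, knot values) -/
  d : PWKernel
  /-- the slack -/
  s : ℚ
  /-- the nodes carrying fake weights -/
  nodeList : List ℕ
  /-- the fake weights `a n` (only `n ∈ nodeList` are read) -/
  a : ℕ → ℚ
  /-- claimed slope constant `≥ ‖x E_χ‖₁ + Σ_n a_n log n` -/
  slope : ℚ
  /-- dyadic precision of the digamma bounds -/
  prec : ℕ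
  /-- digamma series terms on the grid: `mw + mws ⌊u⌋` at the point `u` -/
  mw : ℕ
  /-- growth of the number of digamma series terms with `u` -/
  mws : ℕ
  /-- digamma series terms at `Y₀` -/
  mwT : ℕ
  /-- size of the logarithm table -/
  logN : ℕ

namespace PWData

variable (D : PWData)

/-- **The density** `F_D(y) = Re ψ(1/4+iy/2) − log π + s + Ê_χ(y) − Σ_n a_n cos(y log n)`. [folklore] -/
def F (y : ℝ) : ℝ :=
  reDigammaQuarter y - Real.log π + D.s + cosTransform D.d.kernelE y -
    ∑ n ∈ D.nodeList.toFinset, (D.a n : ℝ) * Real.cos (y * Real.log n)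

/-! ## The checker -/

/-- Knot data `(cosh(x_k/2), sinh(x_k/2))` (garbage where the engine declines; see `checkKnots`). [folklore] -/
def csAt (k : ℕ) : FI × FI := (PW.coshSinhFI (D.d.knot k)).getD (FI.ofInt 0, FI.ofInt 0)

/-- `e^{x_k/2}` (garbage where the engine declines; see `checkKnots`). [folklore] -/
def expAt (k : ℕ) : FI := (PW.expFI (D.d.knot k / 2)).getD (FI.ofInt 0)

/-- The engine accepts all knots `k ≤ K + 1`. [folklore] -/
def checkKnots : Bool :=
  allBelow (D.d.K + 2) fun k => (PW.coshSinhFI (D.d.knot k)).isSome && (PW.expFI (D.d.knot k / 2)).isSome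

/-- Number of digamma series terms used at the grid point `u`. [folklore] -/
def mwAt (u : ℚ) : ℕ := D.mw + D.mws * (Rat.floor u).toNat

/-- The certified lower bound of `F_D` on the cell `[u, v]` (`none` if the engine declines). [folklore] -/
def cellLo (u v : ℚ) : Option ℚ :=
  match CB.expI (FI.ofRat (D.d.L * u)), CB.expI (FI.ofRat (D.d.h * u)) with
  | some Z0, some W =>
    some (wLoQ D.prec u (D.mwAt u) - logPiHi + D.s +
      (PW.ehatFI D.d D.csAt (fun k => CB.mul Z0 (PW.cbPow W k)) u).loQ -
      (PW.combFI D.nodeList D.a D.logN u).hiQ - (v - u) * D.slope)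
  | _, _ => none

/-- The cell `[u, v]` passes. [folklore] -/
def cellOK (u v : ℚ) : Bool :=
  match D.cellLo u v with
  | some q => decide (0 ≤ q) && decide (u ≤ v)
  | none => false

/-- All consecutive cells of a grid pass. [folklore] -/
def checkGrid : List ℚ → Bool
  | [] => false
  | [_] => true
  | u :: v :: rest => D.cellOK u v && checkGrid (v :: rest)

/-- The last point of a grid. [folklore] -/
def lastQ : List ℚ → ℚ
  | [] => 0
  | [x] => x
  | _ :: v :: rest => lastQ (v :: rest)

/-- Upper bound of `Σ_n a_n log n` (the Lipschitz constant of the comb). [folklore] -/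
def combSlopeQ : ℚ :=
  (D.nodeList.map fun n => D.a n * ((FI.logTable D.logN).getD n (FI.ofInt 0)).hiQ).sum

/-- Upper bound of the Lipschitz constant `2(4L sinh(L/2) − 8cosh(L/2) + 8) + x_K (Ê_{|χ|}(0) − 8 sinh(L/2))`
of `Ê_χ` (`none` if the engine declines). [folklore] -/
def lipHi : Option ℚ :=
  match CB.expI (FI.ofRat (D.d.L * 0)), CB.expI (FI.ofRat (D.d.h * 0)), PW.coshSinhFI D.d.L with
  | some Z0, some W, some CS =>
    some (2 * (4 * D.d.L * CS.2.hiQ - 8 * CS.1.loQ + 8) +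
      D.d.knot D.d.K * ((PW.ehatFI D.d.absKernel D.csAt (fun k => CB.mul Z0 (PW.cbPow W k)) 0).hiQ - 8 * CS.2.loQ))
  | _, _, _ => none

/-- The slope constant dominates the Lipschitz constants of `Ê_χ` and of the comb. [folklore] -/
def checkSlope : Bool :=
  match D.lipHi with
  | some e => decide (0 ≤ e) && decide (0 ≤ D.combSlopeQ) && decide (e + D.combSlopeQ ≤ D.slope)
  | none => false

/-- Enclosure of the decay constant of `Ê_χ`. [folklore] -/
def decayFI : FI :=
  (FI.ofRat 4).mul ((((D.expAt 1).add (D.expAt 0)).mul (FI.ofRat (1 / D.d.h))).add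
    (PW.fiSumIco (fun k => (FI.ofRat |D.d.chiAt k|).mul
      ((((D.expAt (k - 1)).add ((FI.ofRat 2).mul (D.expAt k))).add (D.expAt (k + 1))).mul
        (FI.ofRat (1 / D.d.h)))) D.d.K))

/-- The tail beyond `Y₀` passes. [folklore] -/
def checkTail (Y0 : ℚ) : Bool :=
  decide (0 ≤ wLoQ D.prec Y0 D.mwT - logPiHi + D.s - (D.nodeList.map D.a).sum -
    D.decayFI.hiQ / (1 / 4 + Y0 * Y0))

/-- **The scalar checks** (everything except the grid cells): data sanity, engine acceptance of the
knots, the slope constant, and the tail beyond `Y₀`. [folklore] -/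
def checkScalars (Y0 : ℚ) : Bool :=
  decide (0 ≤ D.d.L) && decide (0 < D.d.h) && decide D.nodeList.Nodup &&
    (D.nodeList.all fun n => decide (0 ≤ D.a n) && decide (n ≤ D.logN) && decide (1 ≤ n)) &&
    FI.logTableOK D.logN && D.checkKnots && D.checkSlope && D.checkTail Y0

/-- The grids `gs` chain from `st` to `stop`: each starts where the previous one ends. [folklore] -/
def chainOK : List (List ℚ) → ℚ → ℚ → Bool
  | [], st, stop => decide (st = stop)
  | g :: rest, st, stop => decide (g.head? = some st) && chainOK rest (lastQ g) stop

end PWData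

end Summit.RiemannHypothesis.RiemannHypothesis.Theorems.SignCone

end
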